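import Summits.QuantumFields.YangMills.Theorems.BalabanUVNodesN15PerCubeGreenKnit335Small
import Summits.QuantumFields.YangMills.Theorems.BalabanUVNodesN15CurvedLocalSpeciesOfReg335UN
import Summits.QuantumFields.YangMills.Theorems.BalabanUVNodesN15TwoSpacingGluingCurvedKnitReg335Box
import HarnessLib

/-!
# N15 = NE2, road (c) — PROGRAMME (PC), (PC-F) «the per-cube KNIT», VI — THE CONSUMER FACE, KEYED TO r06's `Reg335Cube` BY NAME: for EVERY `U(m)`-valued background in
# [Balaban1985BackgroundPropagators]'s PER-CUBE regularity class (3.35) with small letters, BAŁABAN's OPERATOR `Δ_{R_U} + a·Q*(U)Q(U) − D_U(I − R(U))D*_U` HAS A TWO-SIDED INVERSE WITH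
# EXPONENTIAL BLOCK DECAY — no gauges, no potentials, no rows, no thresholds displayed (dag-n15-c g30, n15-c∕321)

Cell `pub-ymgap`, seat `pub-ymgap-dag-n15-c` (generation g30; R134 (a), s1; HUMAN RULING D-0062).  `bears_on: R4∕N15 · K3⁸ SpineGivenEndpointR13SepCoPHV (stmt-QuantumFields-27366)`;
filed `--kind proof --supports stmt-QuantumFields-27366 --as helper` — COUNT-NEUTRAL.  ONE theorem, 0 `def`, 0 `sorry`; bookkeeping, no new estimate.  Imports BY NAME n15-c∕320
`…PerCubeGreenKnit335Small` (★★★★ `cvP_cvGlued_spec_perCube335_small`), dag-n15-w2's `…CurvedLocalSpeciesOfReg335UN` (★ `uN_mem_unitaryGroup_of_norm_le_one`: r06's «gauge of unitary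
type» IS a `U(m)` gauge), n15-c∕127 `…CurvedKnitReg335Box` (`blockOf_shift_mem_cubeBlocks`); lit-balaban r06's `B9Eq335RegularityClasses.Reg335Cube` = [B9] (3.35) on a cube BY NAME.
Nothing in the tree is modified.

WHY — THE STATEMENT A CONSUMER WANTS.  n15-c∕319∕320 conclude about the seat's glued operator `cvGlued` built from per-cube gauges `w_k` and potentials `A_k` given as a DATUM.  A consumer
(the η-defect lane (PC-E), the K3⁸ junction) wants: «for `U` in the class, the operator is invertible and the inverse decays».  THIS FILE keys the datum to r06's predicate and hides the
construction: from `Reg335Cube scShift U η □⁺_k ξ C` on the box ONE BLOCK LARGER than the locality box (`□⁺_k = c(Lw+6w−m₀+1,k)+[0,Lw+16w+4)`) it takes the class's gauge `u_k` («of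
unitary type»: `‖u_k‖, ‖u_k⁻¹‖ ≤ 1` on `□⁺_k` ⟹ unitary there), EXTENDS it by `1` off `□⁺_k` (unitary everywhere), observes `U^{w_k} = U^{u_k} = e^{iηA_k}` on the locality box (its fine
one-step shifts stay in `□⁺_k`), runs n15-c∕320, and returns the glued operator as the witness `G`.

WHAT.  ★★★★★ `exists_inverse_decay_of_reg335Cube` — for odd `L ≥ 17`, masses `a₀, a > 0`, colour `ι`: `∃ δ B > 0` such that for all trace-form coordinates `e` of `M_m(ℂ)` (`m ≥ 1`):
`∃ ε₀ > 0, w₂` such that on every doubled torus of the cover (`k ≥ 1`, `L^m ≥ w₂`), for EVERY unitary site bond field `U` and letters `ξ, C > 0` with `C∕ξ ≤ ε₀`, `C∕ξ² ≤ ε₀`: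
IF `U ∈ Reg335Cube(□⁺_k; ξ, C)` for every cube `k` of the cover, THEN there is `G` with `G ≤ B·e^{−(δ∕16)|y−y′|_T}` blockwise, `G∘A_U = 1`, `A_U∘G = 1`,
`A_U = Δ_{R_U} + a·Q*(U)Q(U) − D_U(I−R(U))D*_U` (the seat's `covLapM + (cvNL − cvNVq − cvNVr)` at the transporters of `U`).

HONEST FRAMING ∕ LIMITS.  MODEL carriers and operator (doubled-torus cover `2L·L^m`, one averaging level, uniform weights in `Δ′_a`, one-level staircases, `Q(U)` = main term (125) of
[Balaban1985Averaging] (124), colour through trace-form coordinates, crude constants); ONE `ξ` for all cubes (the print's `L^j η` tower of scales in (3.35) is not modelled); `ε₀, w₂` depend on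
the coordinate system `e`.  This is the per-cube-class analogue IN THE MODEL of [Balaban1985BackgroundPropagators] Thm 3.1∕3.3's «G(U) exists and decays for U satisfying (3.35), Mα₀ small»;
it is NOT Thm 3.1∕3.3 AS PRINTED.  NE2⁺ NOT PRINTED, NOT proved; N15 of record untouched (DISCHARGED AS CONSUMED, p687738) — no re-pin, nothing re-claimed; K3⁸ OPEN; counts UNMOVED
(typed 28∕28); one finite 𝕋⁴ at fixed ε per index — NOT infinite volume, NOT OS on ℝ⁴, NOT a mass gap, NOT Clay.  Restate-immune (no Theses import).
-/

noncomputable section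

open scoped BigOperators Matrix Matrix.Norms.L2Operator

namespace Summit.QuantumFields.YangMills.BalabanUVNodes.N15.Gluing

open Real
open Literature.MathematicalPhysics.QuantumFieldTheory.Balaban1983to89
open Literature.MathematicalPhysics.QuantumFieldTheory.Balaban1983to89.B5Prop11Plancherel (Tor fine unitVec)
open Literature.MathematicalPhysics.QuantumFieldTheory.Balaban1983to89.B11SectG (BlockNorm HasMaj)
open Literature.MathematicalPhysics.QuantumFieldTheory.Balaban1983to89.B6Prop26Gluing (mulOp)
open Literature.MathematicalPhysics.QuantumFieldTheory.Balaban1983to89.B6UnitTorusCarrier (unitTorusGeo)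
open Literature.MathematicalPhysics.QuantumFieldTheory.Balaban1983to89.B9Eq335RegularityClasses (Reg335Cube)
open Literature.MathematicalPhysics.QuantumFieldTheory.Balaban1983to89.B9Eq3117Current (gaugeTr gaugeTr_apply)
open Literature.MathematicalPhysics.QuantumFieldTheory.Balaban1983to89.B9Eq39Adjoint (covD fluct)
open Literature.MathematicalPhysics.QuantumFieldTheory.King1986.Torus (blockOf)
open Literature.Barriers.QuantumFields (traceForm)
open Summit.QuantumFields.YangMills.BalabanUVNodes.N15.BackgroundLayer (covLapM)
open Summit.QuantumFields.YangMills.BalabanUVNodes.N15.VectorPiece (bshiftEquiv)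
open Summit.QuantumFields.YangMills.BalabanUVNodes.N15.MatrixSpecies (coordMat)
open Summit.QuantumFields.YangMills.BalabanUVNodes.N15.TwoGrid (cubeBlocks)
open Summit.QuantumFields.YangMills.BalabanUVNodes.N15.CurvedSpecies (gaugePair uN_mem_unitaryGroup_of_norm_le_one)

variable {d : ℕ} {L : ℕ} [NeZero L]

/-- ★★★★★ **BAŁABAN's OPERATOR IS INVERTIBLE WITH DECAY FOR EVERY BACKGROUND IN THE PER-CUBE CLASS (3.35) — r06's `Reg335Cube` BY NAME, NOTHING ELSE DISPLAYED.**  For odd `L ≥ 17`,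
`a₀, a > 0`, colour `ι`: `∃ δ B > 0`, for all trace-form coordinates `e` of `M_m(ℂ)`: `∃ ε₀ > 0, w₂`, on every doubled torus of the cover (`k ≥ 1`, `L^m ≥ w₂`), for EVERY unitary site field
`U`, letters `ξ, C > 0`, `C∕ξ ≤ ε₀`, `C∕ξ² ≤ ε₀`: `(∀ k, Reg335Cube scShift U η □⁺_k ξ C) ⟹ ∃ G, G ≤ B·e^{−(δ∕16)d} blockwise ∧ G∘A_U = 1 ∧ A_U∘G = 1`,
`A_U = Δ_{R_U} + a·Q*(U)Q(U) − D_U(I−R(U))D*_U`.  MODEL; NOT [B9] Thm 3.1∕3.3 as printed.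
[cite: Balaban1985BackgroundPropagators, (3.35) p.396, Thm 3.1 p.397 and Thm 3.3 p.399 (shape: «G(U) … for U satisfying (3.35)»), (3.26) p.395, (3.49) p.399, (3.59)–(3.65) pp.402–403, Cor. 3.8 p.410; Balaban1984PropagatorsII, (2.91)–(2.93) p.239] -/
theorem exists_inverse_decay_of_reg335Cube (hL : Odd L ∧ 1 < L) (hL17 : 17 ≤ L) {a₀ : ℝ} (ha₀ : 0 < a₀) {a : ℝ} (ha : 0 < a) (ι : Type) [Fintype ι] [DecidableEq ι] :
    ∃ δ B : ℝ, 0 < δ ∧ 0 < B ∧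
      ∀ {mm : Type} [Fintype mm] [DecidableEq mm] [Nonempty mm] (e : Matrix mm mm ℂ ≃L[ℝ] (ι → ℝ)), (∀ A B : Matrix mm mm ℂ, traceForm A B = e A ⬝ᵥ e B) →
      ∃ ε₀ w₂ : ℝ, 0 < ε₀ ∧
      ∀ (mv kk : ℕ), 1 ≤ kk → w₂ ≤ ((L ^ mv : ℕ) : ℝ) →
      ∀ (U : Fin (d + 1) → ScX d L mv kk hL → (Matrix mm mm ℂ)ˣ), (∀ μ x, (U μ x : Matrix mm mm ℂ) ∈ Matrix.unitaryGroup mm ℂ) →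
      ∀ (ξ C : ℝ), 0 < ξ → 0 < C → C / ξ ≤ ε₀ → C / ξ ^ 2 ≤ ε₀ →
        (∀ k : Fin (d + 1) → ZMod (2 * L), Reg335Cube (scShift d L mv kk hL) U ((((L ^ kk : ℕ) : ℝ))⁻¹) {x : ScX d L mv kk hL | blockOf (L ^ kk) (cvM d L mv kk hL) x ∈ cubeBlocks (cvM d L mv kk hL) (coverCorner (cvM d L mv kk hL) (L ^ mv) L (L * L ^ mv + 6 * L ^ mv - coverMargin L mv + 1) k) (L * L ^ mv + 16 * L ^ mv + 4)} ξ C) →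
        ∃ G : (CvX d L mv kk hL × ι → ℝ) →ₗ[ℝ] (CvX d L mv kk hL × ι → ℝ),
          HasMaj (CvNorm d L mv kk hL ι) (CvNorm d L mv kk hL ι) G (fun y y' => B * Real.exp (-(δ / 16 * (unitTorusGeo L kk (cvM d L mv kk hL)).dist y y'))) ∧
          G ∘ₗ (covLapM (bshiftEquiv (cvM d L mv kk hL) (L ^ kk)) ((((L ^ kk : ℕ) : ℝ))⁻¹) (gaugePair (bshiftEquiv (cvM d L mv kk hL) (L ^ kk)) (fun μ x => coordMat e (ContinuousLinearMap.mulLeftRight ℝ (Matrix mm mm ℂ) ((U μ x.1 : Matrix mm mm ℂ)) ((U μ x.1 : Matrix mm mm ℂ))ᴴ))) + (cvNL d L mv kk hL a ι - cvNVq d L mv kk hL a ι e (fun μ x => (U μ x.1 : Matrix mm mm ℂ)) - cvNVr d L mv kk hL a ι e (fun μ x => (U μ x.1 : Matrix mm mm ℂ)))) = LinearMap.id ∧ (covLapM (bshiftEquiv (cvM d L mv kk hL) (L ^ kk)) ((((L ^ kk : ℕ) : ℝ))⁻¹) (gaugePair (bshiftEquiv (cvM d L mv kk hL) (L ^ kk))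 (fun μ x => coordMat e (ContinuousLinearMap.mulLeftRight ℝ (Matrix mm mm ℂ) ((U μ x.1 : Matrix mm mm ℂ)) ((U μ x.1 : Matrix mm mm ℂ))ᴴ))) + (cvNL d L mv kk hL a ι - cvNVq d L mv kk hL a ι e (fun μ x => (U μ x.1 : Matrix mm mm ℂ)) - cvNVr d L mv kk hL a ι e (fun μ x => (U μ x.1 : Matrix mm mm ℂ)))) ∘ₗ G = LinearMap.id := by
  classical
  obtain ⟨δ, B, hδ, hB, H⟩ := cvP_cvGlued_spec_perCube335_small (d := d) hL hL17 ha₀ ha ι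
  refine ⟨δ, B, hδ, hB, fun {mm} _ _ _ e he => ?_⟩
  obtain ⟨ε₀, w₂, hε0, H2⟩ := H e he
  refine ⟨ε₀, max w₂ 4, hε0, fun mv kk hk hw => ?_⟩
  intro U hU ξ C hξ hC hs hs2 h335
  have hw₂ : w₂ ≤ ((L ^ mv : ℕ) : ℝ) := (le_max_left _ _).trans hw
  have hW4 : 4 ≤ L ^ mv := by
    have h4 : (4 : ℝ) ≤ ((L ^ mv : ℕ) : ℝ) := (le_max_right _ _).trans hw
    exact_mod_cast h4
  have hM : ∀ ν, cvM d L mv kk hL ν = 2 * L * L ^ mv := MP_succ_eq L mv kk hL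
  have hcm := coverMargin_fit (show 3 ≤ L by omega) mv
  have h17 : 17 * L ^ mv ≤ L * L ^ mv := Nat.mul_le_mul_right _ hL17
  have e2 : 2 * L * L ^ mv = 2 * (L * L ^ mv) := by ring
  have hS : L * L ^ mv + 16 * L ^ mv + 4 ≤ 2 * L * L ^ mv := by rw [e2]; omega
  -- the locality box and its fine one-step shifts lie in the box one block larger
  have hplus : ∀ (k : Fin (d + 1) → ZMod (2 * L)) (x : ScX d L mv kk hL), blockOf (L ^ kk) (cvM d L mv kk hL) x ∈ cubeBlocks (cvM d L mv kk hL) (coverCorner (cvM d L mv kk hL) (L ^ mv) L (L * L ^ mv + 6 * L ^ mv - coverMargin L mv) k) (L * L ^ mv + 16 * L ^ mv + 2) →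
      blockOf (L ^ kk) (cvM d L mv kk hL) x ∈ cubeBlocks (cvM d L mv kk hL) (coverCorner (cvM d L mv kk hL) (L ^ mv) L (L * L ^ mv + 6 * L ^ mv - coverMargin L mv + 1) k) (L * L ^ mv + 16 * L ^ mv + 4) ∧ ∀ μ, blockOf (L ^ kk) (cvM d L mv kk hL) (scShift d L mv kk hL μ x) ∈ cubeBlocks (cvM d L mv kk hL) (coverCorner (cvM d L mv kk hL) (L ^ mv) L (L * L ^ mv + 6 * L ^ mv - coverMargin L mv + 1) k) (L * L ^ mv + 16 * L ^ mv + 4) := fun k x hx =>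
    ⟨(blockOf_shift_mem_cubeBlocks (m₀ := L * L ^ mv + 6 * L ^ mv - coverMargin L mv + 1) (S₀ := L * L ^ mv + 16 * L ^ mv + 4) hM (by omega) (by omega) hS hx 0).1,
      fun μ => (blockOf_shift_mem_cubeBlocks (m₀ := L * L ^ mv + 6 * L ^ mv - coverMargin L mv + 1) (S₀ := L * L ^ mv + 16 * L ^ mv + 4) hM (by omega) (by omega) hS hx μ).2.1⟩
  -- the per-cube gauges and potentials of the class (3.35), chosen once; the gauges extended by `1` off the larger box
  choose u A hu hg hA hD using h335
  obtain ⟨w, hw⟩ : ∃ w : (Fin (d + 1) → ZMod (2 * L)) → ScX d L mv kk hL → (Matrix mm mm ℂ)ˣ,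
      ∀ k x, w k x = if blockOf (L ^ kk) (cvM d L mv kk hL) x ∈ cubeBlocks (cvM d L mv kk hL) (coverCorner (cvM d L mv kk hL) (L ^ mv) L (L * L ^ mv + 6 * L ^ mv - coverMargin L mv + 1) k) (L * L ^ mv + 16 * L ^ mv + 4) then u k x else 1 := ⟨fun k x => if blockOf (L ^ kk) (cvM d L mv kk hL) x ∈ cubeBlocks (cvM d L mv kk hL) (coverCorner (cvM d L mv kk hL) (L ^ mv) L (L * L ^ mv + 6 * L ^ mv - coverMargin L mv + 1) k) (L * L ^ mv + 16 * L ^ mv + 4) then u k x else 1, fun k x => rfl⟩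
  have hwU : ∀ k x, (w k x : Matrix mm mm ℂ) ∈ Matrix.unitaryGroup mm ℂ := fun k x => by
    rw [hw]
    by_cases hx : blockOf (L ^ kk) (cvM d L mv kk hL) x ∈ cubeBlocks (cvM d L mv kk hL) (coverCorner (cvM d L mv kk hL) (L ^ mv) L (L * L ^ mv + 6 * L ^ mv - coverMargin L mv + 1) k) (L * L ^ mv + 16 * L ^ mv + 4)
    · rw [if_pos hx]
      exact uN_mem_unitaryGroup_of_norm_le_one (u k x) (hu k x hx).1 (hu k x hx).2
    · rw [if_neg hx, Units.val_one]
      exact Submonoid.one_mem _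
  have hdat : ∀ k : Fin (d + 1) → ZMod (2 * L), ∃ A : Fin (d + 1) → ScX d L mv kk hL → Matrix mm mm ℂ,
      (∀ μ, ∀ z ∈ {x : ScX d L mv kk hL | blockOf (L ^ kk) (cvM d L mv kk hL) x ∈ cubeBlocks (cvM d L mv kk hL) (coverCorner (cvM d L mv kk hL) (L ^ mv) L (L * L ^ mv + 6 * L ^ mv - coverMargin L mv) k) (L * L ^ mv + 16 * L ^ mv + 2)}, gaugeTr (scShift d L mv kk hL) (w k) U μ z = fluct ((((L ^ kk : ℕ) : ℝ))⁻¹) A μ z) ∧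
      (∀ μ, ∀ z ∈ {x : ScX d L mv kk hL | blockOf (L ^ kk) (cvM d L mv kk hL) x ∈ cubeBlocks (cvM d L mv kk hL) (coverCorner (cvM d L mv kk hL) (L ^ mv) L (L * L ^ mv + 6 * L ^ mv - coverMargin L mv) k) (L * L ^ mv + 16 * L ^ mv + 2)}, ‖A μ z‖ < C * ξ⁻¹) ∧
      (∀ μ ν, ∀ z ∈ {x : ScX d L mv kk hL | blockOf (L ^ kk) (cvM d L mv kk hL) x ∈ cubeBlocks (cvM d L mv kk hL) (coverCorner (cvM d L mv kk hL) (L ^ mv) L (L * L ^ mv + 6 * L ^ mv - coverMargin L mv) k) (L * L ^ mv + 16 * L ^ mv + 2)}, ‖((↑((((L ^ kk : ℕ) : ℝ))⁻¹)) : ℂ)⁻¹ • covD (scShift d L mv kk hL) (fun _ _ => (1 : (Matrix mm mm ℂ)ˣ)) μ (A ν) z‖ < C * (ξ ^ 2)⁻¹) := fun k =>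
    ⟨A k, fun μ z hz => by
        obtain ⟨h0, h1⟩ := hplus k z hz
        rw [gaugeTr_apply, hw, hw, if_pos h0, if_pos (h1 μ), ← gaugeTr_apply]
        exact hg k μ z h0,
      fun μ z hz => hA k μ z (hplus k z hz).1, fun μ ν z hz => hD k μ ν z (hplus k z hz).1⟩
  exact ⟨_, H2 mv kk hk hw₂ U hU ξ C hξ hC hs hs2 w hwU hdat⟩

end Summit.QuantumFields.YangMills.BalabanUVNodes.N15.Gluing

end
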